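import Literature.NumberTheory.NumberFields.EquivariantIwasawaLemmaCompositumSplit
import Literature.NumberTheory.NumberFields.EquivariantIwasawaLemmaTotallyRamified
import HarnessLib

/-!
# The equivariant Iwasawa lemma, XII: `ℤ_p`-extension layers and a totally ramified prime, with the base
# hypothesis on the `S`-split class group — PROVED

Topic `NumberTheory/NumberFields` (namespace = path, grouping sub-namespace `EquivariantIwasawaLemma`).
THEOREM-ONLY file (no definition, no named fact, no `sorry`), written by the literature seat
`bsd-potss-conjA-anchor` g17 (cell `bsd-potss`; serves the asides stmt-BirchSwinnertonDyer-19386 / 19413;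
closes nothing).  The `S`-versions of files VI and VII
(`EquivariantIwasawaLemmaRamification.lean`, `EquivariantIwasawaLemmaTotallyRamified.lean`):

* `equivariantHom_classGroup_eq_zero_layer_compositum_tower_of_splitAt` — `L_n = L₀K_n`, `K_n` the layers
  of a `ℤ_p`-extension `κ` of the number field `k`, `p ∤ [L₀ : k]`, `V` a `p`-torsion `Γ_k`-module with
  `Γ_{L₀}` trivial, (c3*) `V^{D_v} = 0` at the places `v ∣ p`, (orbit)ₙ; at the bottom ONLY
  `Hom_{Γ_k}(H′_{L₀,Sk}, V) = 0` and (c3*) in stabiliser form at the primes of `L₁` above `Sk` ⟹ every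
  `Γ_k`-equivariant additive `Cl(𝓞_{L_{n+1}}) → V` is zero (file VI's proof verbatim over file XI).
* `equivariantHom_classGroup_eq_zero_layer_compositum_tower_of_totallyRamified_of_splitAt` — the same with
  the orbit input produced from a prime totally ramified in `K_∞/k` (file VII's
  `exists_orbit_input_of_totallyRamified`).

## References

* L. C. Washington, *Introduction to Cyclotomic Fields*, 2nd ed., GTM 83 (1997), §13.1 Prop. 13.2, §13.3,
  Thm. 10.4. [Washington1997]
* S. V. Deo, A. Ray, R. Sujatha, Pure Appl. Math. Q. 19 (2023), §3 Thm. 3.8 (c2), (c3) (arXiv:2202.09937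
  p. 9). [DeoRaySujatha2023]
* J.-P. Serre, *Local Fields*, GTM 67 (1979), Ch. I §7 Prop. 22. [SerreLocalFields1979]
-/

noncomputable section

open scoped Pointwise nonZeroDivisors
open NumberField Field IntermediateField Ideal IsDedekindDomain
open Literature.NumberTheory.GaloisRepresentations
open Literature.NumberTheory.EllipticCurves (ringOfIntegersToIntegralClosure
  coe_ringOfIntegersToIntegralClosure ringOfIntegersToIntegralClosure_comp_algebraMap
  ringOfIntegersToIntegralClosure_injective ZpExtension)

namespace Literature.NumberTheory.NumberFields

namespace EquivariantIwasawaLemma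

section RamificationS

variable {k : Type} [Field k]

/-- `τ|_E = 1` iff `τ ∈ Gal(k̄/E)` (`fixingSubgroup`). [folklore] -/
private theorem absRestrictNormalHom_eq_one_iff_mem_fixingSubgroupR
    (E : IntermediateField k (AlgebraicClosure k)) [Normal k E] (τ : absoluteGaloisGroup k) :
    absRestrictNormalHom E τ = 1 ↔ absoluteGaloisGroup.toAlgEquiv k τ ∈ E.fixingSubgroup := by
  have hc : ∀ x : E, ((absRestrictNormalHom E τ x : E) : AlgebraicClosure k) =
      τ • (x : AlgebraicClosure k) := fun x => AlgEquiv.restrictNormalHom_apply E _ x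
  rw [IntermediateField.mem_fixingSubgroup_iff]
  constructor
  · intro h x hx
    change τ • x = x
    rw [← hc ⟨x, hx⟩, h, AlgEquiv.one_apply]
  · intro h
    ext x
    rw [hc x, AlgEquiv.one_apply]
    exact h x x.2

variable [NumberField k]

/-- `g|_{K_m} = 1 ↔ g ∈ κ⁻¹(pᵐℤ_p)` (tree `fixingSubgroup_layer`). [folklore] -/
private theorem absRestrictNormalHom_layer_eq_one_iffR {p : ℕ} [Fact p.Prime] (κ : ZpExtension k p)
    (m : ℕ) [Normal k (κ.layer m)] (g : absoluteGaloisGroup k) :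
    absRestrictNormalHom (κ.layer m) g = 1 ↔ g ∈ κ.layerSubgroup m := by
  rw [absRestrictNormalHom_eq_one_iff_mem_fixingSubgroupR, κ.fixingSubgroup_layer m]
  constructor
  · rintro ⟨g', hg', hgg'⟩
    have : g' = g := (absoluteGaloisGroup.toAlgEquiv k).injective hgg'
    exact this ▸ hg'
  · exact fun h => ⟨g, h, rfl⟩

omit [NumberField k] in
/-- `ℤ̄_k` is integral over `𝓞 F` along `ι_F`. [folklore] -/
private theorem isIntegral_ringOfIntegersToIntegralClosureR
    (F : IntermediateField k (AlgebraicClosure k)) :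
    (ringOfIntegersToIntegralClosure (k := k) (Ω := AlgebraicClosure k) F).IsIntegral := by
  letI : Algebra (𝓞 F) (integralClosure (𝓞 k) (AlgebraicClosure k)) :=
    (ringOfIntegersToIntegralClosure (k := k) (Ω := AlgebraicClosure k) F).toAlgebra
  haveI : IsScalarTower (𝓞 k) (𝓞 F) (integralClosure (𝓞 k) (AlgebraicClosure k)) :=
    IsScalarTower.of_algebraMap_eq (R := 𝓞 k) (S := 𝓞 F)
      (A := integralClosure (𝓞 k) (AlgebraicClosure k)) fun _ ↦ rfl
  intro x
  change IsIntegral (𝓞 F) x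
  exact (Algebra.IsIntegral.isIntegral (R := 𝓞 k) x).tower_top

set_option maxHeartbeats 1600000 in
set_option synthInstance.maxHeartbeats 200000 in
/-- **The equivariant Iwasawa lemma along `L_n = L₀K_n` (`K_n` the layers of a `ℤ_p`-extension), with the
base hypothesis on the `S`-split class group.**  As file VI's
`equivariantHom_classGroup_eq_zero_layer_compositum_tower` (`k` a number field, `p` odd, `κ` a
`ℤ_p`-extension with layers `K_n`, `L₀ ⊆ k̄` finite Galois with `p ∤ [L₀ : k]`, `V` a `p`-torsion
`Γ_k`-module with `Γ_{L₀}` trivial, (c3*) `V^{D_v} = 0` for the places `v ∣ p`, (orbit)ₙ for every `n`), but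
at the bottom only: every additive `Γ_k`-equivariant `μ : Cl(𝓞_{L₀}) → V` killing the classes of the primes
of `L₀` above the places in `Sk` is zero, plus (c3*) in stabiliser form at the primes of `L₁ = L₀K₁` above
`Sk`.  Then for every `n` every additive `Γ_k`-equivariant `Cl(𝓞_{L₀K_{n+1}}) → V` is zero.
[cite: Washington1997, §13.1 Prop. 13.2, §13.3 Lemmas 13.14–13.15 and Thm. 10.4 (proof)]
[cite: DeoRaySujatha2023, §3 Thm. 3.8 (c2), (c3) and the definition of H′_L (arXiv:2202.09937 p. 9)] -/
theorem equivariantHom_classGroup_eq_zero_layer_compositum_tower_of_splitAt {p : ℕ} [Fact p.Prime]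
    (hp2 : p ≠ 2) (κ : ZpExtension k p)
    (L₀ : IntermediateField k (AlgebraicClosure k)) [FiniteDimensional k L₀] [IsGalois k L₀]
    [NumberField L₀]
    (hL₀ : ¬ p ∣ Module.finrank k L₀)
    [hfd : ∀ n, FiniteDimensional k (κ.layer n)] [hgal : ∀ n, IsGalois k (κ.layer n)]
    [hNF : ∀ n, NumberField (L₀ ⊔ κ.layer n : IntermediateField k (AlgebraicClosure k))]
    {V : Type*} [AddCommGroup V] [DistribMulAction (absoluteGaloisGroup k) V]
    (hpV : ∀ v : V, p • v = 0)
    (hV : ∀ τ : absoluteGaloisGroup k, absRestrictNormalHom L₀ τ = 1 → ∀ v : V, τ • v = v)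
    (Sk : HeightOneSpectrum (𝓞 k) → Prop)
    (hDbad : ∀ (𝔓 : Ideal (𝓞 (L₀ ⊔ κ.layer 1 : IntermediateField k (AlgebraicClosure k))))
      [𝔓.IsMaximal] (u : HeightOneSpectrum (𝓞 k)), Sk u → 𝔓.under (𝓞 k) = u.asIdeal →
      ∀ v : V, (∀ τ : absoluteGaloisGroup k,
        absRestrictNormalHom (L₀ ⊔ κ.layer 1 : IntermediateField k (AlgebraicClosure k)) τ • 𝔓 = 𝔓 →
          τ • v = v) → v = 0)
    (h0 : ∀ μ : Additive (ClassGroup (𝓞 L₀)) →+ V,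
      (∀ (τ : absoluteGaloisGroup k) (c : ClassGroup (𝓞 L₀)),
        μ (Additive.ofMul (ClassGroup.mulEquiv
          (AmbiguousClass.intAut (absRestrictNormalHom L₀ τ)) c)) = τ • μ (Additive.ofMul c)) →
      (∀ (v : HeightOneSpectrum (𝓞 L₀)) (u : HeightOneSpectrum (𝓞 k)), Sk u →
        v.asIdeal.under (𝓞 k) = u.asIdeal →
        μ (Additive.ofMul (ClassGroup.mk0 ⟨v.asIdeal, mem_nonZeroDivisors_of_ne_zero v.ne_bot⟩)) = 0) →
      μ = 0)
    (hD : ∀ v : HeightOneSpectrum (𝓞 k), ((p : ℕ) : 𝓞 k) ∈ v.asIdeal →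
      ∀ w : V, (∀ d ∈ EllipticCurves.GreenbergSelmer.decomp v, d • w = w) → w = 0)
    (horb : ∀ n : ℕ, ∃ (𝔓' : Ideal (absIntegers (𝓞 k) k)) (_ : 𝔓'.IsMaximal)
      (σ : absoluteGaloisGroup k), σ ∈ 𝔓'.inertia (absoluteGaloisGroup k) ∧
        absRestrictNormalHom L₀ σ = 1 ∧ σ ∈ κ.layerSubgroup n ∧ σ ∉ κ.layerSubgroup (n + 1) ∧
        ¬ p ∣ (MulAction.stabilizer
          ((L₀ ⊔ κ.layer (n + 1) : IntermediateField k (AlgebraicClosure k)) ≃ₐ[k]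
            (L₀ ⊔ κ.layer (n + 1) : IntermediateField k (AlgebraicClosure k)))
          (𝔓'.comap (ringOfIntegersToIntegralClosure (k := k) (Ω := AlgebraicClosure k)
            (L₀ ⊔ κ.layer (n + 1) : IntermediateField k (AlgebraicClosure k))))).index)
    (n : ℕ)
    (f : Additive (ClassGroup (𝓞 (L₀ ⊔ κ.layer (n + 1) : IntermediateField k (AlgebraicClosure k))))
      →+ V)
    (hf : ∀ (τ : absoluteGaloisGroup k)
        (c : ClassGroup (𝓞 (L₀ ⊔ κ.layer (n + 1) : IntermediateField k (AlgebraicClosure k)))),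
      f (Additive.ofMul (ClassGroup.mulEquiv (AmbiguousClass.intAut
        (absRestrictNormalHom (L₀ ⊔ κ.layer (n + 1) : IntermediateField k (AlgebraicClosure k)) τ))
          c)) = τ • f (Additive.ofMul c)) :
    f = 0 := by
  haveI hKn : ∀ m, Normal k (κ.layer m) := fun m => inferInstance
  refine equivariantHom_classGroup_eq_zero_compositum_tower_of_splitAt
    (hKab := fun m => κ.isAbelianGalois_layer m)
    p hp2 L₀ hL₀ κ.layer (fun m => κ.layer_mono (Nat.le_succ m)) κ.layer_zero
    (fun m => κ.finrank_layer_holds m) hpV hV Sk hDbad h0 ?_ ?_ n f hf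
  · -- (c3*)ₙ from the place-wise (c3*)
    intro m 𝔓 _ hex w hw
    obtain ⟨σ, hI, -, -, hne⟩ := hex
    exact eq_zero_of_forall_stabilizer_smul_of_layer_ne_one κ (m + 1)
      (L₀ ⊔ κ.layer (m + 1) : IntermediateField k (AlgebraicClosure k)) le_sup_right 𝔓 ⟨σ, hI, hne⟩
      hD w hw
  · -- the ramified prime with few conjugates, from `𝔓̄` and `σ`
    intro m
    obtain ⟨𝔓', h𝔓'max, σ, hσI, h0σ, hn, hn1, hidx⟩ := horb m
    haveI : 𝔓'.IsMaximal := h𝔓'max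
    haveI : (𝔓'.comap (ringOfIntegersToIntegralClosure (k := k) (Ω := AlgebraicClosure k)
        (L₀ ⊔ κ.layer (m + 1) : IntermediateField k (AlgebraicClosure k)))).IsMaximal :=
      @Ideal.isMaximal_comap_of_isIntegral_of_isMaximal' _ _ _ _ _
        (isIntegral_ringOfIntegersToIntegralClosureR _) 𝔓' h𝔓'max
    refine ⟨_, this, ⟨σ, ?_, h0σ, (absRestrictNormalHom_layer_eq_one_iffR κ m σ).mpr hn,
      fun h => hn1 ((absRestrictNormalHom_layer_eq_one_iffR κ (m + 1) σ).mp h)⟩, hidx⟩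
    rw [inertia_comap_ringOfIntegers_eq_map_absRestrictNormalHom
      (L₀ ⊔ κ.layer (m + 1) : IntermediateField k (AlgebraicClosure k)) 𝔓']
    exact Subgroup.mem_map_of_mem _ hσI

set_option maxHeartbeats 1600000 in
set_option synthInstance.maxHeartbeats 200000 in
/-- **Door L6 with the base hypothesis on the `S`-split class group, for a `ℤ_p`-extension with a totally
ramified prime.**  As file VII's
`equivariantHom_classGroup_eq_zero_layer_compositum_tower_of_totallyRamified` (orbit input from a maximal
ideal `𝔓̄` of `ℤ̄_k` with `I_𝔓̄ · Gal(k̄/K_∞) = Γ_k`), with (c2*) at `L₀` weakened to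
`Hom_{Γ_k}(H′_{L₀,Sk}, V) = 0` plus (c3*) in stabiliser form at the primes of `L₀K₁` above `Sk`:
for every `n`, every additive `Γ_k`-equivariant `Cl(𝓞_{L₀K_{n+1}}) → V` is zero.
[cite: Washington1997, §13.1 Prop. 13.2, §13.3 Lemmas 13.14–13.15 and Thm. 10.4 (proof)]
[cite: DeoRaySujatha2023, §3 Thm. 3.8 (c2), (c3) (arXiv:2202.09937 p. 9)] -/
theorem equivariantHom_classGroup_eq_zero_layer_compositum_tower_of_totallyRamified_of_splitAt
    {p : ℕ} [Fact p.Prime] (hp2 : p ≠ 2) (κ : ZpExtension k p)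
    (L₀ : IntermediateField k (AlgebraicClosure k)) [FiniteDimensional k L₀] [IsGalois k L₀]
    [NumberField L₀]
    (hL₀ : ¬ p ∣ Module.finrank k L₀)
    [∀ n, FiniteDimensional k (κ.layer n)] [∀ n, IsGalois k (κ.layer n)]
    [∀ n, NumberField (L₀ ⊔ κ.layer n : IntermediateField k (AlgebraicClosure k))]
    (hram : ∃ 𝔓' : Ideal (absIntegers (𝓞 k) k), 𝔓'.IsMaximal ∧
      𝔓'.inertia (absoluteGaloisGroup k) ⊔ κ.kerSubgroup = ⊤)
    {V : Type*} [AddCommGroup V] [DistribMulAction (absoluteGaloisGroup k) V]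
    (hpV : ∀ v : V, p • v = 0)
    (hV : ∀ τ : absoluteGaloisGroup k, absRestrictNormalHom L₀ τ = 1 → ∀ v : V, τ • v = v)
    (Sk : HeightOneSpectrum (𝓞 k) → Prop)
    (hDbad : ∀ (𝔓 : Ideal (𝓞 (L₀ ⊔ κ.layer 1 : IntermediateField k (AlgebraicClosure k))))
      [𝔓.IsMaximal] (u : HeightOneSpectrum (𝓞 k)), Sk u → 𝔓.under (𝓞 k) = u.asIdeal →
      ∀ v : V, (∀ τ : absoluteGaloisGroup k,
        absRestrictNormalHom (L₀ ⊔ κ.layer 1 : IntermediateField k (AlgebraicClosure k)) τ • 𝔓 = 𝔓 →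
          τ • v = v) → v = 0)
    (h0 : ∀ μ : Additive (ClassGroup (𝓞 L₀)) →+ V,
      (∀ (τ : absoluteGaloisGroup k) (c : ClassGroup (𝓞 L₀)),
        μ (Additive.ofMul (ClassGroup.mulEquiv
          (AmbiguousClass.intAut (absRestrictNormalHom L₀ τ)) c)) = τ • μ (Additive.ofMul c)) →
      (∀ (v : HeightOneSpectrum (𝓞 L₀)) (u : HeightOneSpectrum (𝓞 k)), Sk u →
        v.asIdeal.under (𝓞 k) = u.asIdeal →
        μ (Additive.ofMul (ClassGroup.mk0 ⟨v.asIdeal, mem_nonZeroDivisors_of_ne_zero v.ne_bot⟩)) = 0) →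
      μ = 0)
    (hD : ∀ v : HeightOneSpectrum (𝓞 k), ((p : ℕ) : 𝓞 k) ∈ v.asIdeal →
      ∀ w : V, (∀ d ∈ EllipticCurves.GreenbergSelmer.decomp v, d • w = w) → w = 0)
    (n : ℕ)
    (f : Additive (ClassGroup (𝓞 (L₀ ⊔ κ.layer (n + 1) : IntermediateField k (AlgebraicClosure k))))
      →+ V)
    (hf : ∀ (τ : absoluteGaloisGroup k)
        (c : ClassGroup (𝓞 (L₀ ⊔ κ.layer (n + 1) : IntermediateField k (AlgebraicClosure k)))),
      f (Additive.ofMul (ClassGroup.mulEquiv (AmbiguousClass.intAut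
        (absRestrictNormalHom (L₀ ⊔ κ.layer (n + 1) : IntermediateField k (AlgebraicClosure k)) τ))
          c)) = τ • f (Additive.ofMul c)) :
    f = 0 := by
  obtain ⟨𝔓', h𝔓'max, hsup⟩ := hram
  haveI := h𝔓'max
  refine equivariantHom_classGroup_eq_zero_layer_compositum_tower_of_splitAt hp2 κ L₀ hL₀ hpV hV Sk
    hDbad h0 hD ?_ n f hf
  intro m
  obtain ⟨σ, hσI, h0σ, hn, hn1, hidx⟩ := exists_orbit_input_of_totallyRamified κ L₀ hL₀ hsup m
  exact ⟨𝔓', h𝔓'max, σ, hσI, h0σ, hn, hn1, hidx⟩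

end RamificationS

end EquivariantIwasawaLemma

end Literature.NumberTheory.NumberFields

end
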